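import Summits.FinalStateConjecture.FinalStateConjecture.Theorems.EIHFluxBalanceInertialRecessionStubSlaving12JetCompare
import Summits.FinalStateConjecture.FinalStateConjecture.Theorems.EIHFluxBalanceInertialRecessionStubSlaving3ZeroSet

/-!
# Route EIHFluxBalance — `InertialRecession` (E′), line `SketchCleanExcision`, skeleton r13,
# stub `stub_higherOrderSlaving` (EF): Ricci comparison through the jets at a general point, and
# the frozen boosted Kerr reference

Helper file for the crux `stmt-FinalStateConjecture-17403`
(`Summit.FinalStateConjecture.FinalStateConjecture.Theses.EIHFluxBalance.InertialRecession`, E′),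
registered stub `stub_higherOrderSlaving` (orders two and three of frozen-vacuum slaving).

* `higherOrder_norm_ricAt_le_of_jets_at`, `higherOrder_norm_fderiv_ricAt_le_of_jets_at` — the
  `C²`/`C³` comparison lemmas of `…StubSlaving12JetCompare` at a general base point and with a
  general bound `Γ ≥ 1` on the jets of the compared field (no zoom needed);
* `higherOrder_boostedKerr_reference` — the frozen painted summand `boostedKerrBilin L c M a` is a
  field of metric components on `{r(L⁻¹(x − c)) > 0}` with `Ric = 0` and `D[Ric] = 0` there;
* `higherOrder_norm_sharpAt_le` — `‖♯_G(x)‖ ≤ m⁻¹` if `m‖v‖ ≤ ‖G(x)v‖`.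

No definitions, no named facts, no `sorry`.
-/

set_option linter.dupNamespace false
set_option maxSynthPendingDepth 6
set_option synthInstance.maxHeartbeats 200000

noncomputable section

namespace Summit.FinalStateConjecture.FinalStateConjecture.Theorems.SublinearIsFree.Slaving

open scoped Topology ContDiff
open Filter Set Function Metric Literature.Geometry.Lorentzian
  Summit.FinalStateConjecture.FinalStateConjecture.Theorems
open MetricCoord

/-! ### Comparison through the jets at a general point -/

/-- The sup norm of a difference of jets with the same base point. [folklore] -/
theorem higherOrder_norm_jet_sub_le (x : E4) {A A' : E4 →L[ℝ] E4 →L[ℝ] ℝ}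
    {B B' : E4 →L[ℝ] E4 →L[ℝ] E4 →L[ℝ] ℝ} {C C' : E4 →L[ℝ] E4 →L[ℝ] E4 →L[ℝ] E4 →L[ℝ] ℝ} {δ : ℝ}
    (hδ : 0 ≤ δ) (hA : ‖A - A'‖ ≤ δ) (hB : ‖B - B'‖ ≤ δ) (hC : ‖C - C'‖ ≤ δ) :
    ‖((x, A, B, C) : E4 × (E4 →L[ℝ] E4 →L[ℝ] ℝ) × (E4 →L[ℝ] E4 →L[ℝ] E4 →L[ℝ] ℝ) ×
      (E4 →L[ℝ] E4 →L[ℝ] E4 →L[ℝ] E4 →L[ℝ] ℝ)) - (x, A', B', C')‖ ≤ δ := by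
  simp only [Prod.mk_sub_mk, sub_self, Prod.norm_def, norm_zero]
  exact max_le hδ (max_le hA (max_le hB hC))

/-- **`C²` comparison through the jets at a general point.** [folklore] -/
theorem higherOrder_norm_ricAt_le_of_jets_at {G G' : E4 → E4 →L[ℝ] E4 →L[ℝ] ℝ} {W W' : Set E4} {x : E4}
    (hG : IsMetricOn G W) (hG' : IsMetricOn G' W') (hx : x ∈ W) (hx' : x ∈ W')
    (hR0 : ricAt G x = 0)
    {K : Set (E4 × (E4 →L[ℝ] E4 →L[ℝ] ℝ) × (E4 →L[ℝ] E4 →L[ℝ] E4 →L[ℝ] ℝ) ×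
      (E4 →L[ℝ] E4 →L[ℝ] E4 →L[ℝ] E4 →L[ℝ] ℝ))} {r L₀ δ : ℝ} (hL₀ : 0 ≤ L₀)
    (hLip₀ : ∀ j' ∈ K, ∀ j, ‖j - j'‖ ≤ r → ‖ricciJet (E := E4) j - ricciJet (E := E4) j'‖ ≤ L₀ * ‖j - j'‖)
    (hK : ((x, G' x, fderiv ℝ G' x, fderiv ℝ (fderiv ℝ G') x)) ∈ K)
    (hδ : 0 ≤ δ) (hδr : δ ≤ r) (hd0 : ‖G x - G' x‖ ≤ δ)
    (hd1 : ‖fderiv ℝ G x - fderiv ℝ G' x‖ ≤ δ)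
    (hd2 : ‖fderiv ℝ (fderiv ℝ G) x - fderiv ℝ (fderiv ℝ G') x‖ ≤ δ) :
    ‖ricAt G' x‖ ≤ L₀ * δ := by
  have hJJ' := higherOrder_norm_jet_sub_le x hδ hd0 hd1 hd2
  have hRJ : ricciJet (E := E4) (x, G x, fderiv ℝ G x, fderiv ℝ (fderiv ℝ G) x) = 0 := by
    rw [← ricAt_eq_ricciJet hG hx]; exact hR0
  have hRJ' : ricciJet (E := E4) (x, G' x, fderiv ℝ G' x, fderiv ℝ (fderiv ℝ G') x) = ricAt G' x :=
    (ricAt_eq_ricciJet hG' hx').symm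
  have h := hLip₀ _ hK _ (hJJ'.trans hδr)
  rw [hRJ, zero_sub, norm_neg, hRJ'] at h
  exact h.trans (mul_le_mul_of_nonneg_left hJJ' hL₀)

/-- Norm of a jet map with components bounded by `Γ ≥ 1`. [folklore] -/
theorem higherOrder_norm_jetCLM_le {F₁ F₂ F₃ : Type*} [NormedAddCommGroup F₁] [NormedSpace ℝ F₁]
    [NormedAddCommGroup F₂] [NormedSpace ℝ F₂] [NormedAddCommGroup F₃] [NormedSpace ℝ F₃]
    (D₁ : E4 →L[ℝ] F₁) (D₂ : E4 →L[ℝ] F₂) (D₃ : E4 →L[ℝ] F₃) {Γ : ℝ} (hΓ : 1 ≤ Γ)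
    (h₁ : ‖D₁‖ ≤ Γ) (h₂ : ‖D₂‖ ≤ Γ) (h₃ : ‖D₃‖ ≤ Γ) :
    ‖(ContinuousLinearMap.id ℝ E4).prod (D₁.prod (D₂.prod D₃))‖ ≤ Γ := by
  refine ContinuousLinearMap.opNorm_le_bound _ (zero_le_one.trans hΓ) fun v ↦ ?_
  simp only [ContinuousLinearMap.prod_apply, ContinuousLinearMap.id_apply, Prod.norm_def]
  have hv := norm_nonneg v
  refine max_le (by nlinarith) (max_le ?_ (max_le ?_ ?_))
  · exact (D₁.le_opNorm v).trans (mul_le_mul_of_nonneg_right h₁ hv)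
  · exact (D₂.le_opNorm v).trans (mul_le_mul_of_nonneg_right h₂ hv)
  · exact (D₃.le_opNorm v).trans (mul_le_mul_of_nonneg_right h₃ hv)

/-- **Operator-norm bookkeeping for the chain rule** with `‖L'‖ ≤ Γ`: if `A₁ ∘ L = 0`,
`‖A₂ − A₁‖ ≤ a`, `‖A₁‖ ≤ b`, `‖L' − L‖ ≤ d`, then `‖A₂ ∘ L'‖ ≤ a Γ + b d`. [folklore] -/
theorem higherOrder_norm_comp_le_of_comp_eq_zero {E P Q : Type*} [NormedAddCommGroup E] [NormedSpace ℝ E]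
    [NormedAddCommGroup P] [NormedSpace ℝ P] [NormedAddCommGroup Q] [NormedSpace ℝ Q]
    {A₁ A₂ : P →L[ℝ] Q} {L L' : E →L[ℝ] P} {a b d Γ : ℝ} (h0 : A₁.comp L = 0)
    (ha : ‖A₂ - A₁‖ ≤ a) (hL' : ‖L'‖ ≤ Γ) (hb : ‖A₁‖ ≤ b) (hd : ‖L' - L‖ ≤ d) (ha0 : 0 ≤ a) :
    ‖A₂.comp L'‖ ≤ a * Γ + b * d := by
  have hb0 : 0 ≤ b := (norm_nonneg _).trans hb
  have hid : A₂.comp L' = (A₂ - A₁).comp L' + A₁.comp (L' - L) := by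
    rw [ContinuousLinearMap.sub_comp, ContinuousLinearMap.comp_sub, h0, sub_zero, sub_add_cancel]
  rw [hid]
  calc ‖(A₂ - A₁).comp L' + A₁.comp (L' - L)‖
      ≤ ‖(A₂ - A₁).comp L'‖ + ‖A₁.comp (L' - L)‖ := norm_add_le _ _
    _ ≤ ‖A₂ - A₁‖ * ‖L'‖ + ‖A₁‖ * ‖L' - L‖ :=
        add_le_add (ContinuousLinearMap.opNorm_comp_le _ _) (ContinuousLinearMap.opNorm_comp_le _ _)
    _ ≤ a * Γ + b * d :=
        add_le_add (mul_le_mul ha hL' (norm_nonneg _) ha0) (mul_le_mul hb hd (norm_nonneg _) hb0)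

set_option maxHeartbeats 1600000 in
/-- **`C³` comparison through the jets at a general point, with jets bounded by `Γ ≥ 1`.**
[folklore] -/
theorem higherOrder_norm_fderiv_ricAt_le_of_jets_at {G G' : E4 → E4 →L[ℝ] E4 →L[ℝ] ℝ} {W W' : Set E4}
    {x : E4} (hG : IsMetricOn G W) (hG' : IsMetricOn G' W') (hx : x ∈ W) (hx' : x ∈ W')
    (hDR0 : fderiv ℝ (ricAt G) x = 0)
    {K : Set (E4 × (E4 →L[ℝ] E4 →L[ℝ] ℝ) × (E4 →L[ℝ] E4 →L[ℝ] E4 →L[ℝ] ℝ) ×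
      (E4 →L[ℝ] E4 →L[ℝ] E4 →L[ℝ] E4 →L[ℝ] ℝ))} {r L₁ B₁ δ Γ : ℝ} (hL₁ : 0 ≤ L₁) (hΓ : 1 ≤ Γ)
    (hLip₁ : ∀ j' ∈ K, ∀ j, ‖j - j'‖ ≤ r →
      ‖fderiv ℝ (ricciJet (E := E4)) j - fderiv ℝ (ricciJet (E := E4)) j'‖ ≤ L₁ * ‖j - j'‖ ∧
        ‖fderiv ℝ (ricciJet (E := E4)) j‖ ≤ B₁)
    (hK : ((x, G' x, fderiv ℝ G' x, fderiv ℝ (fderiv ℝ G') x)) ∈ K)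
    (hδ : 0 ≤ δ) (hδr : δ ≤ r) (hd0 : ‖G x - G' x‖ ≤ δ)
    (hd1 : ‖fderiv ℝ G x - fderiv ℝ G' x‖ ≤ δ)
    (hd2 : ‖fderiv ℝ (fderiv ℝ G) x - fderiv ℝ (fderiv ℝ G') x‖ ≤ δ)
    (hd3 : ‖fderiv ℝ (fderiv ℝ (fderiv ℝ G)) x - fderiv ℝ (fderiv ℝ (fderiv ℝ G')) x‖ ≤ δ)
    (hn1 : ‖fderiv ℝ G' x‖ ≤ Γ) (hn2 : ‖fderiv ℝ (fderiv ℝ G') x‖ ≤ Γ)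
    (hn3 : ‖fderiv ℝ (fderiv ℝ (fderiv ℝ G')) x‖ ≤ Γ) :
    ‖fderiv ℝ (ricAt G') x‖ ≤ (L₁ * Γ + B₁) * δ := by
  have hJJ' := higherOrder_norm_jet_sub_le x hδ hd0 hd1 hd2
  have hcomp := fderiv_ricAt_eq_comp_jetMap hG hx
  have hcomp' := fderiv_ricAt_eq_comp_jetMap hG' hx'
  rw [hDR0] at hcomp
  have hLn : ‖(ContinuousLinearMap.id ℝ E4).prod ((fderiv ℝ G' x).prod ((fderiv ℝ (fderiv ℝ G') x).prod
      (fderiv ℝ (fderiv ℝ (fderiv ℝ G')) x)))‖ ≤ Γ := higherOrder_norm_jetCLM_le _ _ _ hΓ hn1 hn2 hn3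
  have hLd : ‖(ContinuousLinearMap.id ℝ E4).prod ((fderiv ℝ G' x).prod ((fderiv ℝ (fderiv ℝ G') x).prod
      (fderiv ℝ (fderiv ℝ (fderiv ℝ G')) x))) -
      (ContinuousLinearMap.id ℝ E4).prod ((fderiv ℝ G x).prod ((fderiv ℝ (fderiv ℝ G) x).prod
      (fderiv ℝ (fderiv ℝ (fderiv ℝ G)) x)))‖ ≤ δ := by
    refine norm_jetCLM_sub_le _ _ _ _ _ _ hδ ?_ ?_ ?_
    · rw [norm_sub_rev]; exact hd1
    · rw [norm_sub_rev]; exact hd2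
    · rw [norm_sub_rev]; exact hd3
  obtain ⟨hA12, hB⟩ := hLip₁ _ hK _ (hJJ'.trans hδr)
  have hB₁ : 0 ≤ B₁ := (norm_nonneg _).trans hB
  have hA21 : ‖fderiv ℝ (ricciJet (E := E4)) (x, G' x, fderiv ℝ G' x, fderiv ℝ (fderiv ℝ G') x) -
      fderiv ℝ (ricciJet (E := E4)) (x, G x, fderiv ℝ G x, fderiv ℝ (fderiv ℝ G) x)‖ ≤ L₁ * δ := by
    rw [norm_sub_rev]; exact hA12.trans (mul_le_mul_of_nonneg_left hJJ' hL₁)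
  have hA₁B : ‖fderiv ℝ (ricciJet (E := E4)) (x, G x, fderiv ℝ G x, fderiv ℝ (fderiv ℝ G) x)‖ ≤ B₁ := by
    obtain ⟨-, hB'⟩ := hLip₁ _ hK (x, G x, fderiv ℝ G x, fderiv ℝ (fderiv ℝ G) x) (hJJ'.trans hδr)
    exact hB'
  rw [hcomp']
  exact (higherOrder_norm_comp_le_of_comp_eq_zero hcomp.symm hA21 hLn hA₁B hLd (mul_nonneg hL₁ hδ)).trans
    (le_of_eq (by ring))

/-! ### The frozen boosted Kerr reference -/

/-- **The frozen painted summand is a Ricci-flat field of metric components off its singular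
set**, with vanishing derivative of the Ricci form there. [folklore] -/
theorem higherOrder_boostedKerr_reference (L : lorentzGroup) (c : E4) (M a : ℝ) :
    IsMetricOn (boostedKerrBilin L c M a) {z : E4 | 0 < Kerr.radius a (poincareInv L c z)} ∧
    (∀ z : E4, 0 < Kerr.radius a (poincareInv L c z) → ricAt (boostedKerrBilin L c M a) z = 0) ∧
    ∀ z : E4, 0 < Kerr.radius a (poincareInv L c z) → fderiv ℝ (ricAt (boostedKerrBilin L c M a)) z = 0 := by
  have hset : {z : E4 | 0 < Kerr.radius a (poincareInv L c z)} = poincareInv L c ⁻¹' (Kerr.region a 0 : Set E4) := by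
    ext z
    simp only [mem_setOf_eq, mem_preimage, SetLike.mem_coe, Kerr.mem_region, max_self]
  have hG : IsMetricOn (boostedKerrBilin L c M a) {z : E4 | 0 < Kerr.radius a (poincareInv L c z)} := by
    rw [hset, ← pullMetric_kerr_bilin_poincareInv]
    exact (isMetricOn_kerr_bilin M a).isMetricOn_pullMetric (isCoordChangeOn_poincareInv L c a)
  have hric : ∀ z : E4, 0 < Kerr.radius a (poincareInv L c z) → ricAt (boostedKerrBilin L c M a) z = 0 :=
    fun z hz ↦ by ext Y Z; rw [ricAt_boostedKerrBilin L c M a hz]; rfl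
  refine ⟨hG, hric, fun z hz ↦ ?_⟩
  have hev : ricAt (boostedKerrBilin L c M a) =ᶠ[𝓝 z] fun _ ↦ 0 :=
    Filter.eventually_of_mem (hG.isOpen.mem_nhds hz) fun w hw ↦ hric w hw
  rw [hev.fderiv_eq, fderiv_fun_const]
  rfl

/-! ### The operator norm of `♯` from coercivity -/

/-- **`‖♯_G(x)‖ ≤ m⁻¹` if `m ‖v‖ ≤ ‖G(x) v‖` for all `v`** (and `G(x)` is invertible). [folklore] -/
theorem higherOrder_norm_sharpAt_le {G : E4 → E4 →L[ℝ] E4 →L[ℝ] ℝ} {x : E4} {m : ℝ} (hm : 0 < m)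
    (hinv : (G x).IsInvertible) (hcoer : ∀ v : E4, m * ‖v‖ ≤ ‖G x v‖) :
    ‖sharpAt G x‖ ≤ m⁻¹ := by
  refine ContinuousLinearMap.opNorm_le_bound _ (inv_nonneg.2 hm.le) fun α ↦ ?_
  have h := hcoer (sharpAt G x α)
  rw [apply_sharpAt hinv] at h
  rw [inv_mul_eq_div, le_div_iff₀ hm, mul_comm]
  exact h

/-- **Registered one-line carrier form** (`higherOrder_normSharp_EF`) of
`higherOrder_norm_sharpAt_le`. [folklore] -/
theorem higherOrder_normSharp_EF : open Literature.Geometry.Lorentzian MetricCoord in ∀ {G : E4 → E4 →L[ℝ] E4 →L[ℝ] ℝ} {x : E4} {m : ℝ}, 0 < m → (G x).IsInvertible → (∀ v : E4, m * ‖v‖ ≤ ‖G x v‖) → ‖sharpAt G x‖ ≤ m⁻¹ :=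
  fun hm hinv hcoer ↦ higherOrder_norm_sharpAt_le hm hinv hcoer

end Summit.FinalStateConjecture.FinalStateConjecture.Theorems.SublinearIsFree.Slaving

end
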